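import Mathlib.InformationTheory.Hamming
import Mathlib.Algebra.MvPolynomial.CommRing
import Mathlib.Algebra.MvPolynomial.Degrees
import Mathlib.Algebra.Field.ZMod
import Mathlib.LinearAlgebra.Matrix.Determinant.Basic
import Literature.Computability.AlgebraicComplexity.MatMulRankCodeBoundZMod
import Literature.Computability.AlgebraicComplexity.QuadraticComputation
import HarnessLib

/-!
# Linear codes of matrices and the `3n² − o(n²)` lower bounds for `n × n` matrix multiplication over `𝔽₂`, bilinear and quadratic (Shpilka 2001/2003, Theorems 1, 2 and 3)

Topic `Literature/Computability/AlgebraicComplexity` (bilinear complexity over finite fields; the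
coding-theory line Brockett–Dobkin 1978 → Bshouty 1989 → Shpilka 2001, continuing
`BrockettDobkinCodes.lean` / `MatMulRankCodeBoundZMod.lean`). Everything here is PROVED; there are
no named facts.

Source: A. Shpilka, *Lower bounds for matrix product*, SIAM J. Comput. 32 (2003) 1185–1200
(conference version FOCS 2001), read in the held arXiv text `cs/0201001` (statements identical).
As printed:

> **Definition 2.** A linear code of matrices is a mapping `Γ : M_n(GF(2)) → {0,1}^m` (for some `m`)
> with the following properties: • `Γ` is linear. • For any matrix `a`,
> `weight(Γ(a)) ≥ n · rank(a)`.
> **Corollary 2.** `Γ` is a one to one mapping, and for any two matrices `a` and `b`,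
> `d_H(Γ(a), Γ(b)) ≥ n · rank(a − b)`.
> **Theorem 3.** Let `Γ : M_n(GF(2)) → {0,1}^m` be a linear code of matrices, then
> `m ≥ 3n² − O(n^{5/3})`.
> **Lemma 7.** [for a bilinear circuit with product gates `μ_i(x)·η_i(y)` and
> `Γ(x) = (μ_1(x), …, μ_m(x))`] `Γ` is a linear transformation with the property that for every
> matrix `x ∈ M_n`, `weight(Γ(x)) ≥ n · rank(x)`.
> **Theorem 1.** `s_bl ≥ 3n² − O(n^{5/3})` (in other words `R_{GF(2)}(MP_n) ≥ 3n² − O(n^{5/3})`).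
> **Theorem 2.** `s_q ≥ 3n² − O(n^{5/3})`. I.e. the number of product gates in any quadratic circuit
> that computes the product of two `n × n` matrices over `GF(2)` is at least `3n² − O(n^{5/3})`.
> **Lemma 8.** [§4.3, for a quadratic circuit with product gates `μ_k(x,y)·η_k(x,y)`, outputs
> `(x·y)_{i,j} = ∑_k α^{(k)}_{i,j} μ_k η_k`, and `Γ(z) = (γ_k(z))_k`, `γ_k(z) = ∑_{i,j} α^{(k)}_{i,j} z_{i,j}`]
> `Γ` is a linear mapping and it has the property that for every matrix `z`,
> `weight(Γ(z)) ≥ n · rank(z)`. [Proof: the discrete partial derivatives of `trace(x·y·z₀ᵗ)` span a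
> space of dimension `2n·rank(z₀)` inside `span{μ_i, η_i : γ_i(z₀) ≠ 0}`, of dimension `≤ 2k`.]

Printed proof of Theorem 3 (§4.1): by **Lemma 6** (for `k < 2ⁿ` and `n²` independent linear forms
`μ_i` there are `k` matrices `a_1, …, a_k` with all `a_i − a_j` invertible on which `n² − C(k,2)·n`
of the `μ_i` vanish — proved from **Lemma 3**, a small-support non-vanishing lemma applied to the
polynomial `P(a_1, …, a_k) = det ∏_{i<j}(a_i − a_j)` of degree `C(k,2)·n`, and **Lemma 4**, the
embedding `GF(2ⁿ) ↪ M_n(GF(2))`) and **Corollary 1** (Plotkin: `k > 2` words of `{0,1}^t` pairwise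
at distance `≥ N` force `t ≥ 2N − 4N/(k+2)`) applied to `Γ(a_1), …, Γ(a_k)` restricted to the
non-vanishing coordinates, «`m − r ≥ 2n² − 4n²/(k+2)`; since `r ≥ n² − n^{5/3}` and `k = n^{1/3}`, we
get that `m ≥ 3n² − O(n^{5/3})`».

## What is formalised, and how it deviates from the printed text

* `IsLinearCodeOfMatrices` = Definition 2 verbatim (with `Matrix.rank`); `IsMatrixCode` = the two
  consequences the proof USES (`Γ` one-to-one, Cor. 2; `weight(Γ(a)) ≥ n²` for INVERTIBLE `a`);
  `IsLinearCodeOfMatrices.isMatrixCode` derives the latter from the former. Theorem 3 is proved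
  from `IsMatrixCode` alone (weaker hypothesis, same conclusion).
* `shpilka2003_thm3` — Theorem 3 in EXPLICIT form: for every `2 ≤ k ≤ 2ⁿ`,
  `(3k − 2)·n² ≤ k·m + k·n·C(k,2)`, i.e. `m ≥ 3n² − 2n²/k − n·C(k,2)`; the printed `3n² − O(n^{5/3})`
  is the choice `k ≈ n^{1/3}` (`2n²/k + nk²/2 = O(n^{5/3})`). The route is the printed one with two
  simplifications that do not change the architecture: (i) Lemmas 2–3 (Schwartz–Zippel-type
  reduction) are replaced, for `GF(2)`, by the parity identity «a polynomial of total degree `< |S|`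
  sums to zero over the cube `{0,1}^S`» at a non-root of minimal support
  (`Shpilka2003.exists_eval_ne_zero_small_support` — same conclusion: a non-root with at most
  `deg P` nonzero coordinates); (ii) Plotkin's bound is used in the classical form `k·t ≥ 2(k−1)N`
  (`Shpilka2003.plotkin_binary`), slightly sharper than Cor. 1 and valid for `k ≥ 2`. Lemma 4 is the
  tree's regular representation `gfRegRep` (`MatMulRankCodeBoundZMod.lean`). The `n²` independent
  coordinates of the printed proof are an "information set" `C₀` of the code
  (`Shpilka2003.exists_coordSet`).
* `isLinearCodeOfMatrices_code₁` — Lemma 7 AS PRINTED (`weight(Γ(x)) ≥ n·rank(x)` for the first code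
  map `γ₁ = code₁` of any bilinear computation of `⟨n,n,n⟩`, via `n·rank(x) ≤ dim{x·y}` =
  `Shpilka2003.mul_rank_le_finrank_range_mul` and BCS Thm. (18.4) / `BrockettDobkinCodes.lean`);
  `isMatrixCode_code₁` — the two consequences used; `shpilka2003_thm1` — Theorem 1 in the same explicit form for
  `R_{𝔽₂}(⟨n,n,n⟩) = tensorRank (matMulTensor (ZMod 2) n n n)`, and `shpilka2003_thm1_bilinComp` for a
  computation of any length `|ι|`.
* `Shpilka2003.finrank_add_finrank_le_two_mul_card` — Lemma 8's dimension count for ANY quadratic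
  computation of a bilinear map `φ` and any functional `λ` (every field): the left/right partial
  derivative functionals of `λ ∘ φ` (`Shpilka2003.lDer`/`rDer`, explicit combinations `lDer_eq_sum` of the
  `f_t, g_t` with `λ(w_t) ≠ 0`) give `rank_left(λ∘φ) + rank_right(λ∘φ) ≤ 2·#{t : λ(w_t) ≠ 0}`;
  `QuadComp.code₃Mat` — Shpilka's `Γ(z) = (⟨z, w_t⟩)_t` for a quadratic computation of `⟨n,n,n⟩`
  (Frobenius pairing `Shpilka2003.frob`); `isMatrixCode_code₃Mat` — Lemma 8 over `𝔽₂` in the form used,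
  `isLinearCodeOfMatrices_code₃Mat` — Lemma 8 as printed (every rank);
  `shpilka2003_thm2_quadComp` / `shpilka2003_thm2` — Theorem 2 in the same explicit form for the tree's
  multiplicative complexity `mulComplexity (mulBilin (ZMod 2) n n n)` (`QuadraticComputation.lean`,
  BCS (14.2)/(14.4): shortest quadratic computation = the commutative / quadratic-circuit model).
* Instances: `n = 3, k = 2` gives only `15 ≤ R_{𝔽₂}(⟨3,3,3⟩)`
  (`fifteen_le_tensorRank_matMulTensor_three_F2_viaShpilka`) — the theorem is asymptotic and says
  nothing new for `3 × 3` (tree: 17 by `seventeen_le_tensorRank_matMulTensor_three_F2_viaCodes`, 19 by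
  `blaser2003_cor9_holds`, 20 = named fact `Wang2026_thm1`; the Summits side of the venture
  `pub-mm22` has 21); `n = 128, k = 6` gives `41771 ≤ R_{𝔽₂}(⟨128,128,128⟩)`, above
  `(5/2)·128² − 3·128 = 40576` (Bläser 1999's any-field bound) — the `𝔽₂`-specific gain as printed
  («These results improve the former results of [Bshouty89, Blaser99] who proved lower bounds of
  `2.5n² − o(n²)`»); and `shpilka2003_thm2_n128 : 41771 ≤ L_{𝔽₂}(⟨128,128,128⟩)` in the COMMUTATIVE
  model, against the any-field `2n² + n − 3 = 32893` (Bläser 1999, multiplicative complexity; Shpilka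
  §1.1) — for `3 × 3` Theorem 2 is again vacuous (`15`; tree: `17 ≤ L(⟨3,3,3⟩)` every field,
  `QuadraticLafonWinograd.lean`; print `18`).

NOT formalised here: Theorem 4 (`(2.5 + 1.5/(p³ − 1))n² − O(n^{7/4})` for bilinear circuits over
`GF(p)`, §5, via Bläser's Lemma 9 — not in the tree, whose `Blaser1999_rank_lower_bound_holds` goes
through Koszul flattenings) and the second claim of Lemma 5. Lemmas 7 and 8 are ALSO proved as printed,
at every rank (`isLinearCodeOfMatrices_code₁`, `isLinearCodeOfMatrices_code₃Mat`, via
`n·rank(x) ≤ dim{x·y}` and the factorizations `⟨z, x·y⟩ = ⟨xᵀz, y⟩ = ⟨z·yᵀ, x⟩`), although Theorem 3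
uses only the invertible case. `-- TODO(general form): Thm 4 (GF(p)).`

HONEST FRAMING: a classical (2001) `𝔽₂`-specific ASYMPTOTIC lower bound, typed from the held text and
proved; it is vacuous for small formats and changes no number of the `3 × 3` record. 0 named facts.

## References

* A. Shpilka, *Lower bounds for matrix product*, SIAM J. Comput. 32(5) (2003) 1185–1200,
  doi:10.1137/S0097539702405954; Proc. 42nd IEEE FOCS (2001), doi:10.1109/sfcs.2001.959910;
  arXiv:cs/0201001: Def. 1–2, Cor. 1–2, Lemmas 2–8, Thms. 1–3 (§3–§4). [Shpilka2003]
* P. Bürgisser, M. Clausen, M. A. Shokrollahi, *Algebraic Complexity Theory* (1997), Def. (14.2),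
  Prop. (14.4) (quadratic computations, `L`). [BurgisserClausenShokrollahi1997]
* P. Bürgisser, M. Clausen, M. A. Shokrollahi, *Algebraic Complexity Theory* (1997), Thm. (18.4),
  Cor. (18.14), Thm. (18.18). [BurgisserClausenShokrollahi1997]
* N. H. Bshouty, *A lower bound for matrix multiplication*, SIAM J. Comput. 18 (1989) 759–765.
  [BurgisserClausenShokrollahi1997]
-/

namespace Literature.Computability.AlgebraicComplexity

namespace Shpilka2003

open Finset MvPolynomial

/-! ## Plotkin's bound, binary case (Shpilka Lemma 5 (first part) and Corollary 1) -/

section Plotkin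

variable {κ ι : Type*}

/-- Number of coordinates on which two words agree (Shpilka, Def. 1: `agree(u,v) = m − d_H(v,u)`). [cite: Shpilka2003, Def. 1] -/
def agree [Fintype ι] (x y : ι → ZMod 2) : ℕ := #{c | x c = y c}

/-- `agree(u,v) + d_H(u,v) = t`. [cite: Shpilka2003, Def. 1] -/
theorem agree_add_hammingDist [Fintype ι] (x y : ι → ZMod 2) :
    agree x y + hammingDist x y = Fintype.card ι := by
  unfold agree hammingDist
  exact Finset.card_filter_add_card_filter_not _

/-- `agree(u,u) = t`. [cite: Shpilka2003, Def. 1] -/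
theorem agree_self [Fintype ι] (x : ι → ZMod 2) : agree x x = Fintype.card ι := by
  simp [agree]

/-- all elements of `ZMod 2` are `0` or `1`. [folklore] -/
private theorem zmod2_eq_zero_or_one : ∀ a : ZMod 2, a = 0 ∨ a = 1 := by decide

/-- For one coordinate `c`: twice the number of ORDERED pairs `(a, b)` with `v a c = v b c` is at
least `k²` (`2(z² + o²) ≥ (z + o)²`; Shpilka, proof of Lemma 5: «By convexity
`∑_α C(n_α, 2) ≥ k(k − p)/(2p)`»). [cite: Shpilka2003, Lemma 5 (proof)] -/
theorem sq_le_two_mul_card_agreePairs [Fintype κ] [DecidableEq κ] (v : κ → ι → ZMod 2) (c : ι) :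
    Fintype.card κ ^ 2 ≤ 2 * #{p : κ × κ | v p.1 c = v p.2 c} := by
  set z := #{a : κ | v a c = 0} with hz
  set o := #{a : κ | v a c = 1} with ho
  have hzo : z + o = Fintype.card κ := by
    rw [hz, ho, ← Finset.card_union_of_disjoint]
    · rw [← Finset.card_univ]
      congr 1
      ext a
      simp only [Finset.mem_union, Finset.mem_filter, Finset.mem_univ, true_and, iff_true]
      exact zmod2_eq_zero_or_one (v a c)
    · rw [Finset.disjoint_filter]
      intro a _ h0 h1
      rw [h0] at h1
      exact absurd h1 (by decide)
  have hpairs : #{p : κ × κ | v p.1 c = v p.2 c} = z * z + o * o := by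
    have hsplit : (Finset.univ.filter fun p : κ × κ => v p.1 c = v p.2 c) =
        (Finset.univ.filter fun p : κ × κ => v p.1 c = 0 ∧ v p.2 c = 0) ∪
        (Finset.univ.filter fun p : κ × κ => v p.1 c = 1 ∧ v p.2 c = 1) := by
      ext p
      simp only [Finset.mem_filter, Finset.mem_univ, true_and, Finset.mem_union]
      rcases zmod2_eq_zero_or_one (v p.1 c) with h1 | h1 <;>
        rcases zmod2_eq_zero_or_one (v p.2 c) with h2 | h2 <;> simp [h1, h2]
    rw [hsplit, Finset.card_union_of_disjoint]
    · congr 1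
      · rw [hz, ← Finset.card_product]
        congr 1
        ext p
        simp
      · rw [ho, ← Finset.card_product]
        congr 1
        ext p
        simp
    · rw [Finset.disjoint_filter]
      rintro p _ ⟨h0, -⟩ ⟨h1, -⟩
      rw [h0] at h1
      exact absurd h1 (by decide)
  rw [hpairs, ← hzo]
  nlinarith [sq_nonneg ((z : ℤ) - o)]

/-- Double counting: summing the agreeing ordered pairs over the coordinates equals summing the
agreements over the ordered pairs («We are going to estimate `∑_{i<j} agree(v_i, v_j)` in two different
ways»). [cite: Shpilka2003, Lemma 5 (proof)] -/
theorem sum_card_agreePairs_eq [Fintype κ] [Fintype ι] (v : κ → ι → ZMod 2) :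
    ∑ c, #{p : κ × κ | v p.1 c = v p.2 c} = ∑ p : κ × κ, agree (v p.1) (v p.2) := by
  unfold agree
  simp_rw [Finset.card_filter]
  exact Finset.sum_comm

/-- **Plotkin's bound (binary).** If `k ≥ 2` words of length `t` over `𝔽₂` are pairwise at Hamming
distance `≥ N`, then `2(k − 1)N ≤ k·t`. Shpilka's Lemma 5 (first claim, `p = 2`: «In every set of `k`
vectors in `GF(p)^t`, such that `p < k`, there are two vectors that agree on at least `(t/p − t/k)`
coordinates») and Corollary 1 («If `{0,1}^t` contains `k` vectors … such that `2 < k` and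
`∀ i ≠ j d_H(v_i,v_j) ≥ N`, then `t ≥ 2N − 4N/(k+2)`»), here in the slightly sharper classical form
(the convexity step kept exact: two words agree on `≥ t(k−2)/(2(k−1))` coordinates), which also
covers `k = 2`. [cite: Shpilka2003, Lemma 5, Cor. 1] -/
theorem plotkin_binary [Fintype κ] [Fintype ι] [DecidableEq κ] (v : κ → ι → ZMod 2) {N : ℕ}
    (hk : 2 ≤ Fintype.card κ)
    (hd : ∀ a b : κ, a ≠ b → N ≤ hammingDist (v a) (v b)) :
    2 * (Fintype.card κ - 1) * N ≤ Fintype.card κ * Fintype.card ι := by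
  set k := Fintype.card κ with hkdef
  set t := Fintype.card ι with htdef
  set A := ∑ p : κ × κ, agree (v p.1) (v p.2) with hA
  -- (1) k² t ≤ 2 A
  have h1 : k ^ 2 * t ≤ 2 * A := by
    rw [hA, ← sum_card_agreePairs_eq, Finset.mul_sum]
    calc k ^ 2 * t = ∑ _c : ι, k ^ 2 := by rw [Finset.sum_const, Finset.card_univ, smul_eq_mul, mul_comm]
      _ ≤ ∑ c, 2 * #{p : κ × κ | v p.1 c = v p.2 c} :=
          Finset.sum_le_sum fun c _ => sq_le_two_mul_card_agreePairs v c
  -- N ≤ t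
  have hNt : N ≤ t := by
    obtain ⟨a, b, hab⟩ := Fintype.exists_pair_of_one_lt_card (lt_of_lt_of_le one_lt_two hk)
    exact (hd a b hab).trans (hammingDist_le_card_fintype)
  -- (2) A + (k² − k) N ≤ k² t
  have h2 : A + (k * k - k) * N ≤ k * k * t := by
    have hbound : ∀ p : κ × κ, agree (v p.1) (v p.2) ≤ if p.1 = p.2 then t else t - N := by
      intro p
      split_ifs with h
      · rw [h, agree_self]
      · have := agree_add_hammingDist (v p.1) (v p.2)
        have := hd p.1 p.2 h
        omega
    have hsum : A ≤ ∑ p : κ × κ, (if p.1 = p.2 then t else t - N) := Finset.sum_le_sum fun p _ => hbound p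
    have hdiag : #{p : κ × κ | p.1 = p.2} = k := by
      rw [hkdef, ← Finset.card_univ]
      refine Finset.card_bij (fun p _ => p.1) (fun p _ => Finset.mem_univ _) ?_ ?_
      · rintro ⟨a, b⟩ hab ⟨a', b'⟩ hab' h
        simp only [Finset.mem_filter, Finset.mem_univ, true_and] at hab hab'
        simp only at h
        subst hab; subst hab'; subst h; rfl
      · intro a _
        exact ⟨(a, a), by simp, rfl⟩
    have hoff : #{p : κ × κ | ¬ p.1 = p.2} = k * k - k := by
      have := Finset.card_filter_add_card_filter_not (s := (Finset.univ : Finset (κ × κ)))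
        (fun p : κ × κ => p.1 = p.2)
      rw [hdiag, Finset.card_univ, Fintype.card_prod, ← hkdef] at this
      omega
    rw [Finset.sum_ite, Finset.sum_const, Finset.sum_const, hdiag, hoff, smul_eq_mul, smul_eq_mul] at hsum
    have hkk : k ≤ k * k := Nat.le_mul_self k
    calc A + (k * k - k) * N ≤ k * t + (k * k - k) * (t - N) + (k * k - k) * N := by omega
      _ = k * t + (k * k - k) * t := by
          rw [add_assoc, ← Nat.mul_add, Nat.sub_add_cancel hNt]
      _ = k * k * t := by
          rw [← Nat.add_mul, Nat.add_sub_cancel' hkk]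
  -- combine
  have h3 : 2 * ((k * k - k) * N) ≤ k * k * t := by
    have : k ^ 2 = k * k := sq k
    rw [this] at h1
    omega
  have hk0 : 0 < k := by omega
  have h4 : k * (2 * (k - 1) * N) ≤ k * (k * t) := by
    calc k * (2 * (k - 1) * N) = 2 * ((k * (k - 1)) * N) := by ring
      _ = 2 * ((k * k - k) * N) := by rw [Nat.mul_sub_one]
      _ ≤ k * k * t := h3
      _ = k * (k * t) := by ring
  exact Nat.le_of_mul_le_mul_left h4 hk0

end Plotkin

/-! ## A small-support nonvanishing lemma over `𝔽₂` (replaces Shpilka's Lemmas 2–3) -/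

section Parity

variable {σ : Type*} [DecidableEq σ]

/-- Extension by zero of a point of the sub-cube `𝔽₂^S` to `𝔽₂^σ`. [folklore] -/
def extZ (S : Finset σ) (y : S → ZMod 2) : σ → ZMod 2 :=
  fun i => if h : i ∈ S then y ⟨i, h⟩ else 0

/-- `extZ` on `S`. [folklore] -/
@[simp] private theorem extZ_apply_mem (S : Finset σ) (y : S → ZMod 2) {i : σ} (h : i ∈ S) :
    extZ S y i = y ⟨i, h⟩ := by simp [extZ, h]

/-- `extZ` off `S`. [folklore] -/
@[simp] private theorem extZ_apply_not_mem (S : Finset σ) (y : S → ZMod 2) {i : σ} (h : i ∉ S) :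
    extZ S y i = 0 := by simp [extZ, h]

/-- Flipping one coordinate of the sub-cube. [folklore] -/
def flip {S : Finset σ} (i₀ : S) (y : S → ZMod 2) : S → ZMod 2 :=
  Function.update y i₀ (y i₀ + 1)

/-- `flip` is an involution (`1 + 1 = 0` in `𝔽₂`). [folklore] -/
private theorem flip_flip {S : Finset σ} (i₀ : S) (y : S → ZMod 2) : flip i₀ (flip i₀ y) = y := by
  funext i
  unfold flip
  by_cases h : i = i₀
  · subst h
    simp only [Function.update_self]
    have : ∀ a : ZMod 2, a + 1 + 1 = a := by decide
    exact this _
  · simp [Function.update_of_ne h]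

/-- `flip` has no fixed point. [folklore] -/
private theorem flip_ne {S : Finset σ} (i₀ : S) (y : S → ZMod 2) : flip i₀ y ≠ y := by
  intro h
  have := congrFun h i₀
  simp only [flip, Function.update_self] at this
  have h2 : ∀ a : ZMod 2, a + 1 ≠ a := by decide
  exact h2 _ this

/-- `flip i₀` changes only the coordinate `i₀`. [folklore] -/
private theorem extZ_flip_of_ne {S : Finset σ} (i₀ : S) (y : S → ZMod 2) {i : σ} (hi : i ≠ i₀) :
    extZ S (flip i₀ y) i = extZ S y i := by
  by_cases h : i ∈ S
  · rw [extZ_apply_mem _ _ h, extZ_apply_mem _ _ h]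
    unfold flip
    rw [Function.update_of_ne]
    exact fun heq => hi (by rw [← heq])
  · rw [extZ_apply_not_mem _ _ h, extZ_apply_not_mem _ _ h]

/-- A monomial missing the variable `i₀ ∈ S` takes the same value at `y` and at `flip i₀ y`. [folklore] -/
private theorem prod_pow_extZ_flip [Fintype σ] {S : Finset σ} (i₀ : S) (y : S → ZMod 2) (d : σ →₀ ℕ)
    (hd : d i₀ = 0) :
    ∏ i, extZ S (flip i₀ y) i ^ d i = ∏ i, extZ S y i ^ d i := by
  refine Finset.prod_congr rfl fun i _ => ?_
  by_cases hi : i = i₀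
  · rw [hi, hd, pow_zero, pow_zero]
  · rw [extZ_flip_of_ne i₀ y hi]

/-- Over `𝔽₂`, a monomial of degree `< |S|` sums to zero over the sub-cube `𝔽₂^S` (extended by zero):
either it contains a variable outside `S` (then it vanishes termwise) or it misses a variable
`i₀ ∈ S` (then flipping `i₀` pairs the points off). [folklore] -/
private theorem sum_prod_pow_extZ_eq_zero [Fintype σ] (S : Finset σ) (d : σ →₀ ℕ)
    (hd : (d.sum fun _ e => e) < S.card) :
    ∑ y : S → ZMod 2, ∏ i, extZ S y i ^ d i = 0 := by
  by_cases hout : ∃ i, i ∉ S ∧ d i ≠ 0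
  · obtain ⟨i, hiS, hdi⟩ := hout
    refine Finset.sum_eq_zero fun y _ => ?_
    exact Finset.prod_eq_zero (Finset.mem_univ i) (by rw [extZ_apply_not_mem _ _ hiS, zero_pow hdi])
  · push Not at hout
    -- some `i₀ ∈ S` has exponent zero
    have hex : ∃ i₀ ∈ S, d i₀ = 0 := by
      by_contra hne
      push Not at hne
      have hle : S.card ≤ d.sum fun _ e => e := by
        calc S.card = ∑ i ∈ S, 1 := by simp
          _ ≤ ∑ i ∈ S, d i := Finset.sum_le_sum fun i hi => Nat.one_le_iff_ne_zero.mpr (hne i hi)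
          _ ≤ ∑ i ∈ d.support, d i := by
              refine Finset.sum_le_sum_of_subset_of_nonneg (fun i hi => ?_) fun _ _ _ => Nat.zero_le _
              exact Finsupp.mem_support_iff.mpr (hne i hi)
          _ = d.sum fun _ e => e := rfl
      exact absurd hd (not_lt.mpr hle)
    obtain ⟨i₀, hi₀S, hdi₀⟩ := hex
    refine Finset.sum_ninvolution (flip ⟨i₀, hi₀S⟩) (fun y => ?_) (fun y _ => flip_ne _ y)
      (fun y => Finset.mem_univ _) (fun y => flip_flip _ y)
    rw [prod_pow_extZ_flip ⟨i₀, hi₀S⟩ y d hdi₀]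
    have h2 : ∀ a : ZMod 2, a + a = 0 := by decide
    exact h2 _

/-- Over `𝔽₂`, a polynomial of total degree `< |S|` sums to zero over the sub-cube `𝔽₂^S`. [folklore] -/
private theorem sum_eval_extZ_eq_zero [Fintype σ] (S : Finset σ) (P : MvPolynomial σ (ZMod 2))
    (hP : P.totalDegree < S.card) :
    ∑ y : S → ZMod 2, eval (extZ S y) P = 0 := by
  simp_rw [eval_eq']
  rw [Finset.sum_comm]
  refine Finset.sum_eq_zero fun d hd => ?_
  rw [← Finset.mul_sum, sum_prod_pow_extZ_eq_zero S d ((le_totalDegree hd).trans_lt hP), mul_zero]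

omit [DecidableEq σ] in
/-- the support of a point of `𝔽₂^σ`. [folklore] -/
def supp [Fintype σ] (x : σ → ZMod 2) : Finset σ := Finset.univ.filter fun i => x i ≠ 0

omit [DecidableEq σ] in
/-- membership in the support. [folklore] -/
private theorem mem_supp [Fintype σ] {x : σ → ZMod 2} {i : σ} : i ∈ supp x ↔ x i ≠ 0 := by simp [supp]

/-- **Small-support nonvanishing lemma (`𝔽₂`).** A polynomial function over `𝔽₂` that does not vanish
identically has a non-root with at most `totalDegree` nonzero coordinates. This is the content of
Shpilka's Lemma 2 («If `P ≢ 0` then we can find an assignment, `ρ ∈ Fⁿ`, to the `x_i`'s such that at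
most `d` of the `ρ_i`'s get a nonzero value, and such that `P(ρ_1,…,ρ_n) ≠ 0`») for `F = GF(2)`;
proved here not by reduction of the polynomial but by the parity identity `sum_eval_extZ_eq_zero` at
a non-root of minimal support. [cite: Shpilka2003, Lemma 2, Lemma 3] -/
theorem exists_eval_ne_zero_small_support [Fintype σ] (P : MvPolynomial σ (ZMod 2)) {z : σ → ZMod 2}
    (hz : eval z P ≠ 0) :
    ∃ x : σ → ZMod 2, (supp x).card ≤ P.totalDegree ∧ eval x P ≠ 0 := by
  classical
  set good : Finset (σ → ZMod 2) := Finset.univ.filter fun x => eval x P ≠ 0 with hgood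
  have hne : good.Nonempty := ⟨z, by simp [hgood, hz]⟩
  obtain ⟨x₀, hx₀, hmin⟩ := Finset.exists_min_image good (fun x => (supp x).card) hne
  have hx₀P : eval x₀ P ≠ 0 := by simpa [hgood] using hx₀
  refine ⟨x₀, ?_, hx₀P⟩
  by_contra hlt
  push Not at hlt
  set S := supp x₀ with hS
  have hsum := sum_eval_extZ_eq_zero S P hlt
  -- the sum equals `eval x₀ P`
  set y₀ : S → ZMod 2 := fun i => x₀ i with hy₀
  have hext₀ : extZ S y₀ = x₀ := by
    funext i
    by_cases h : i ∈ S
    · rw [extZ_apply_mem _ _ h]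
    · rw [extZ_apply_not_mem _ _ h]
      rw [hS, mem_supp, not_not] at h
      exact h.symm
  have hone : ∀ a : ZMod 2, a ≠ 0 → a = 1 := by decide
  have hsingle : ∑ y : S → ZMod 2, eval (extZ S y) P = eval x₀ P := by
    rw [Finset.sum_eq_single y₀]
    · rw [hext₀]
    · intro y _ hy
      by_contra hyP
      -- `extZ S y` is a non-root with support inside `S`, hence equal to `S`, hence `y = y₀`
      have hsub : supp (extZ S y) ⊆ S := by
        intro i hi
        rw [mem_supp] at hi
        by_contra hiS
        exact hi (extZ_apply_not_mem _ _ hiS)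
      have hge : S.card ≤ (supp (extZ S y)).card :=
        hmin (extZ S y) (by simp [hgood, hyP])
      have heq : supp (extZ S y) = S := Finset.eq_of_subset_of_card_le hsub hge
      apply hy
      funext i
      have hi1 : extZ S y i ≠ 0 := by rw [← mem_supp, heq]; exact i.2
      rw [extZ_apply_mem _ _ i.2] at hi1
      have hi2 : x₀ i ≠ 0 := by rw [← mem_supp]; exact i.2
      rw [hone _ hi1]
      show (1 : ZMod 2) = x₀ i
      rw [hone _ hi2]
    · intro h
      exact absurd (Finset.mem_univ y₀) h
  rw [hsingle] at hsum
  exact hx₀P hsum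

end Parity

/-! ## Coordinate subsets on which an injective linear map stays injective -/

section InfoSet

open Module

variable {F : Type*} [Field F] {M : Type*} [AddCommGroup M] [Module F M]
variable {ι : Type*}

/-- The coordinates of `Γ` indexed by a finset `S` (a puncturing of the code `Γ(M)`). [folklore] -/
def resCoords (Γ : M →ₗ[F] (ι → F)) (S : Finset ι) : M →ₗ[F] (S → F) :=
  LinearMap.pi fun c : S => (LinearMap.proj (c : ι)).comp Γ

/-- `resCoords` evaluates coordinates. [folklore] -/
@[simp] private theorem resCoords_apply (Γ : M →ₗ[F] (ι → F)) (S : Finset ι) (a : M) (c : S) :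
    resCoords Γ S a c = Γ a c := rfl

/-- An injective puncturing keeps at least `dim M` coordinates. [folklore] -/
private theorem finrank_le_card_of_injective_resCoords [FiniteDimensional F M] (Γ : M →ₗ[F] (ι → F))
    (S : Finset ι) (h : Function.Injective (resCoords Γ S)) : finrank F M ≤ S.card := by
  have := LinearMap.finrank_le_finrank_of_injective h
  simpa [Module.finrank_fintype_fun_eq_card] using this

/-- If more than `dim M` coordinates are kept, one of them is redundant (the coordinate functionals are linearly dependent in `M^*`). [folklore] -/
private theorem exists_erase_of_injective_resCoords [FiniteDimensional F M] [DecidableEq ι]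
    (Γ : M →ₗ[F] (ι → F)) (S : Finset ι)
    (h : Function.Injective (resCoords Γ S)) (hlt : finrank F M < S.card) :
    ∃ c₀ ∈ S, Function.Injective (resCoords Γ (S.erase c₀)) := by
  set μ : S → Module.Dual F M := fun c => (LinearMap.proj (c : ι)).comp Γ with hμ
  have hdep : ¬ LinearIndependent F μ := by
    intro hli
    have := hli.fintype_card_le_finrank
    rw [Subspace.dual_finrank_eq, Fintype.card_coe] at this
    exact absurd hlt (not_lt.mpr this)
  obtain ⟨g, hg, c₀, hc₀⟩ := Fintype.not_linearIndependent_iff.mp hdep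
  refine ⟨c₀, c₀.2, (injective_iff_map_eq_zero _).2 fun a ha => ?_⟩
  apply (injective_iff_map_eq_zero _).1 h a
  have hrest : ∀ c : S, c ≠ c₀ → Γ a c = 0 := by
    intro c hc
    have hmem : (c : ι) ∈ S.erase c₀ :=
      Finset.mem_erase.mpr ⟨fun h' => hc (Subtype.ext h'), c.2⟩
    have := congrFun ha ⟨c, hmem⟩
    simpa using this
  have h0 : Γ a c₀ = 0 := by
    have := LinearMap.congr_fun hg a
    simp only [LinearMap.coe_sum, Finset.sum_apply, LinearMap.smul_apply, LinearMap.zero_apply,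
      hμ, LinearMap.comp_apply, LinearMap.proj_apply, smul_eq_mul] at this
    rw [Finset.sum_eq_single c₀] at this
    · exact (mul_eq_zero.mp this).resolve_left hc₀
    · intro c _ hc
      rw [hrest c hc, mul_zero]
    · intro h'
      exact absurd (Finset.mem_univ _) h'
  funext c
  by_cases hc : c = c₀
  · rw [hc]
    simpa using h0
  · simpa using hrest c hc

/-- **Coordinate bases.** An injective linear map `Γ : M → F^ι` stays injective on some set of
exactly `dim M` coordinates (an "information set" of the code `Γ(M)`; in Shpilka's proof: «Since `Γ` is
a one to one mapping, there are `n²` independent linear forms among `μ_1, …, μ_m`»).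
[cite: Shpilka2003, Thm. 3 (proof)] -/
theorem exists_coordSet [FiniteDimensional F M] [Fintype ι] [DecidableEq ι] (Γ : M →ₗ[F] (ι → F))
    (hΓ : Function.Injective Γ) :
    ∃ C₀ : Finset ι, C₀.card = finrank F M ∧ Function.Injective (resCoords Γ C₀) := by
  have key : ∀ j : ℕ, ∀ S : Finset ι, S.card = finrank F M + j →
      Function.Injective (resCoords Γ S) →
      ∃ C₀ : Finset ι, C₀.card = finrank F M ∧ Function.Injective (resCoords Γ C₀) := by
    intro j
    induction j with
    | zero =>
      intro S hS h
      exact ⟨S, by simpa using hS, h⟩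
    | succ j ih =>
      intro S hS h
      obtain ⟨c₀, hc₀, h'⟩ := exists_erase_of_injective_resCoords Γ S h (by omega)
      exact ih (S.erase c₀) (by rw [Finset.card_erase_of_mem hc₀, hS]; omega) h'
  have huniv : Function.Injective (resCoords Γ Finset.univ) := by
    intro a b hab
    apply hΓ
    funext c
    exact congrFun hab ⟨c, Finset.mem_univ c⟩
  have hle := finrank_le_card_of_injective_resCoords Γ _ huniv
  obtain ⟨j, hj⟩ := Nat.exists_eq_add_of_le hle
  exact key j Finset.univ hj huniv

end InfoSet

/-! ## Degree of a determinant of low-degree polynomial entries -/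

section DetDegree

/-- The determinant of a matrix of polynomials of total degree `≤ d` has total degree `≤ (size)·d`
(«it is easy to see that `deg(P) = C(k,2)·n`»). [cite: Shpilka2003, Lemma 6 (proof)] -/
theorem totalDegree_det_le {m : Type*} [Fintype m] [DecidableEq m] {τ : Type*} {R : Type*}
    [CommRing R] (N : Matrix m m (MvPolynomial τ R)) {d : ℕ}
    (hN : ∀ i j, (N i j).totalDegree ≤ d) :
    N.det.totalDegree ≤ Fintype.card m * d := by
  rw [Matrix.det_apply']
  refine totalDegree_finsetSum_le fun σ _ => ?_
  calc (((Equiv.Perm.sign σ : ℤ) : MvPolynomial τ R) * ∏ i, N (σ i) i).totalDegree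
      ≤ ((Equiv.Perm.sign σ : ℤ) : MvPolynomial τ R).totalDegree
          + (∏ i, N (σ i) i).totalDegree := totalDegree_mul _ _
    _ ≤ 0 + ∑ i, (N (σ i) i).totalDegree := by
        gcongr
        · rcases Int.units_eq_one_or (Equiv.Perm.sign σ) with h | h <;>
            simp [h, totalDegree_neg]
        · exact totalDegree_finsetProd _ _
    _ ≤ 0 + ∑ _i : m, d := by
        gcongr with i _
        exact hN _ _
    _ = Fintype.card m * d := by simp [Finset.sum_const, Finset.card_univ]

end DetDegree

end Shpilka2003

/-! ## Linear codes of matrices (Shpilka, Definition 2) and Theorem 3 -/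

section Codes

open Module Matrix Finset MvPolynomial Shpilka2003

/-- **Definition (Shpilka 2003, Def. 2), as printed.** «A linear code of matrices is a mapping
`Γ : M_n(GF(2)) → {0,1}^m` (for some `m`) with the following properties: • `Γ` is linear. • For any
matrix `a`, `weight(Γ(a)) ≥ n · rank(a)`.» [cite: Shpilka2003, Def. 2] -/
def IsLinearCodeOfMatrices {ι : Type*} [Fintype ι] (n : ℕ)
    (Γ : Matrix (Fin n) (Fin n) (ZMod 2) →ₗ[ZMod 2] (ι → ZMod 2)) : Prop :=
  ∀ a, n * a.rank ≤ hammingNorm (Γ a)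

/-- The two consequences of Definition 2 that the proof of Theorem 3 uses: `Γ` is one-to-one
(Shpilka Cor. 2) and invertible matrices have weight `≥ n² = n · rank`. We prove Theorem 3 from these
alone. [cite: Shpilka2003, Def. 2, Cor. 2] -/
structure IsMatrixCode {ι : Type*} [Fintype ι] (n : ℕ)
    (Γ : Matrix (Fin n) (Fin n) (ZMod 2) →ₗ[ZMod 2] (ι → ZMod 2)) : Prop where
  /-- «`Γ` is a one to one mapping» (Cor. 2) -/
  injective : Function.Injective Γ
  /-- invertible matrices have weight `≥ n²` -/
  sq_le : ∀ a, IsUnit a → n ^ 2 ≤ hammingNorm (Γ a)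

/-- A nonzero matrix has positive rank. [folklore] -/
private theorem Shpilka2003.rank_pos_of_ne_zero {n : ℕ} {a : Matrix (Fin n) (Fin n) (ZMod 2)} (ha : a ≠ 0) :
    0 < a.rank := by
  rw [Matrix.rank_eq_finrank_span_cols, pos_iff_ne_zero, Ne, Submodule.finrank_eq_zero]
  intro hbot
  apply ha
  ext i j
  have hj : a.col j ∈ Submodule.span (ZMod 2) (Set.range a.col) := Submodule.subset_span ⟨j, rfl⟩
  rw [hbot, Submodule.mem_bot] at hj
  simpa using congrFun hj i

/-- A linear code of matrices in the printed sense has the two properties used below («Corollary 2.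
`Γ` is a one to one mapping»; `weight(Γ(a)) ≥ n · rank(a) = n²` for invertible `a`).
[cite: Shpilka2003, Def. 2, Cor. 2] -/
theorem IsLinearCodeOfMatrices.isMatrixCode {ι : Type*} [Fintype ι] {n : ℕ}
    {Γ : Matrix (Fin n) (Fin n) (ZMod 2) →ₗ[ZMod 2] (ι → ZMod 2)}
    (h : IsLinearCodeOfMatrices n Γ) : IsMatrixCode n Γ := by
  refine ⟨(injective_iff_map_eq_zero _).2 fun a ha => ?_, fun a hu => ?_⟩
  · by_contra hne
    rcases Nat.eq_zero_or_pos n with hn | hn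
    · subst hn
      exact hne (Subsingleton.elim _ _)
    · have h1 := h a
      rw [ha, hammingNorm_zero] at h1
      have h2 := Shpilka2003.rank_pos_of_ne_zero hne
      have : n * a.rank = 0 := Nat.le_zero.mp h1
      rcases Nat.mul_eq_zero.mp this with h3 | h3 <;> omega
  · have h1 := h a
    rwa [Matrix.rank_of_isUnit a hu, Fintype.card_fin, ← sq] at h1

/-- **Theorem (Shpilka 2003, Thm. 3), explicit form.** «Let `Γ : M_n(GF(2)) → {0,1}^m be a linear code
of matrices, then `m ≥ 3n² − O(n^{5/3})`.» We prove, for every `2 ≤ k ≤ 2ⁿ`, the explicit inequality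
`(3k − 2)·n² ≤ k·m + k·n·C(k,2)`, i.e. `m ≥ 3n² − 2n²/k − n·C(k,2)` (the printed bound is the case
`k ≈ n^{1/3}`), by the printed route: `k` matrices with pairwise invertible differences on which
`≥ n² − n·C(k,2)` of `n²` independent coordinates of `Γ` vanish (Lemma 6, via the small-support lemma
for `det ∏_{i<j}(a_i − a_j)` and `GF(2ⁿ) ↪ M_n(GF(2))`), then Plotkin's bound on the remaining
coordinates (Cor. 1). Hypotheses: only the two consequences `IsMatrixCode` of Def. 2.
[cite: Shpilka2003, Thm. 3 (proof: Lemma 6, Cor. 1)] -/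
theorem shpilka2003_thm3 {n : ℕ} (hn : n ≠ 0) {ι : Type*} [Fintype ι] [DecidableEq ι]
    {Γ : Matrix (Fin n) (Fin n) (ZMod 2) →ₗ[ZMod 2] (ι → ZMod 2)} (hΓ : IsMatrixCode n Γ)
    {k : ℕ} (hk2 : 2 ≤ k) (hk : k ≤ 2 ^ n) :
    (3 * k - 2) * n ^ 2 ≤ k * Fintype.card ι + k * (n * k.choose 2) := by
  classical
  -- Step 1: a coordinate set `C₀` of size `n²` on which `Γ` is still injective, and the induced
  -- coordinates `e : M ≃ 𝔽₂^{C₀}`.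
  have hfin : finrank (ZMod 2) (Matrix (Fin n) (Fin n) (ZMod 2)) = n * n := by
    simp [Module.finrank_matrix]
  obtain ⟨C₀, hC₀, hinj⟩ := exists_coordSet Γ hΓ.injective
  rw [hfin] at hC₀
  have hdim : finrank (ZMod 2) (Matrix (Fin n) (Fin n) (ZMod 2)) = finrank (ZMod 2) (C₀ → ZMod 2) := by
    rw [hfin, Module.finrank_fintype_fun_eq_card, Fintype.card_coe, hC₀]
  set e : Matrix (Fin n) (Fin n) (ZMod 2) ≃ₗ[ZMod 2] (C₀ → ZMod 2) :=
    LinearMap.linearEquivOfInjective _ hinj hdim with he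
  have e_apply : ∀ a (c : C₀), e a c = Γ a c := fun a c => rfl
  -- matrices with prescribed `C₀`-coordinates
  set b : C₀ → Matrix (Fin n) (Fin n) (ZMod 2) := fun c => e.symm (Pi.single c 1) with hb
  set matOf : (Fin k × C₀ → ZMod 2) → Fin k → Matrix (Fin n) (Fin n) (ZMod 2) :=
    fun x u => ∑ c, x (u, c) • b c with hmatOf
  have matOf_eq : ∀ x u, matOf x u = e.symm (fun c => x (u, c)) := by
    intro x u
    simp only [hmatOf, hb]
    calc ∑ c, x (u, c) • e.symm (Pi.single c 1)
        = e.symm (∑ c, x (u, c) • (Pi.single c (1 : ZMod 2) : C₀ → ZMod 2)) := by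
          rw [map_sum]
          simp_rw [map_smul]
      _ = e.symm (fun c => x (u, c)) := by
          congr 1
          funext c'
          simp [Finset.sum_apply, Pi.single_apply]
  have e_matOf : ∀ x u (c : C₀), Γ (matOf x u) c = x (u, c) := by
    intro x u c
    rw [← e_apply, matOf_eq, LinearEquiv.apply_symm_apply]
  -- Step 2: the polynomial `P = ∏_{u<v} det (A_u − A_v)` in the coordinates.
  set R := MvPolynomial (Fin k × C₀) (ZMod 2) with hR
  set A : Fin k → Matrix (Fin n) (Fin n) R :=
    fun u => Matrix.of fun i j => ∑ c : C₀, X (u, c) * C (b c i j) with hA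
  set pairs : Finset (Fin k × Fin k) := Finset.univ.filter fun p => p.1 < p.2 with hpairs
  set P : R := ∏ p ∈ pairs, (A p.1 - A p.2).det with hP
  -- degree bound
  have hdegA : ∀ u v i j, ((A u - A v) i j).totalDegree ≤ 1 := by
    intro u v i j
    simp only [hA, Matrix.sub_apply, Matrix.of_apply]
    refine (totalDegree_sub _ _).trans (max_le ?_ ?_) <;>
    · refine totalDegree_finsetSum_le fun c _ => ?_
      refine (totalDegree_mul _ _).trans ?_
      rw [totalDegree_X, totalDegree_C]
  have hpairs_card : pairs.card ≤ k.choose 2 := by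
    -- inject `pairs` into the 2-subsets of `Fin k`
    have hc : (Finset.univ.powersetCard 2 : Finset (Finset (Fin k))).card = k.choose 2 := by
      rw [Finset.card_powersetCard, Finset.card_univ, Fintype.card_fin]
    rw [← hc]
    refine Finset.card_le_card_of_injOn (fun p => ({p.1, p.2} : Finset (Fin k))) ?_ ?_
    · intro p hp
      simp only [hpairs, Finset.coe_filter, Finset.mem_univ, true_and, Set.mem_setOf_eq] at hp
      simp only [Finset.mem_coe, Finset.mem_powersetCard, Finset.subset_univ, true_and]
      exact Finset.card_pair (ne_of_lt hp)
    · intro p hp q hq hpq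
      simp only [hpairs, Finset.coe_filter, Finset.mem_univ, true_and, Set.mem_setOf_eq] at hp hq
      have hpq' : ({p.1, p.2} : Finset (Fin k)) = {q.1, q.2} := hpq
      have h1 : p.1 ∈ ({q.1, q.2} : Finset (Fin k)) := by rw [← hpq']; simp
      have h2 : p.2 ∈ ({q.1, q.2} : Finset (Fin k)) := by rw [← hpq']; simp
      simp only [Finset.mem_insert, Finset.mem_singleton] at h1 h2
      rcases h1 with h1 | h1 <;> rcases h2 with h2 | h2
      · exact absurd (h1.trans h2.symm) (ne_of_lt hp)
      · exact Prod.ext h1 h2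
      · rw [h1, h2] at hp; exact absurd (hq.trans hp) (lt_irrefl _)
      · exact absurd (h1.trans h2.symm) (ne_of_lt hp)
  have hdegP : P.totalDegree ≤ n * k.choose 2 := by
    calc P.totalDegree ≤ ∑ p ∈ pairs, (A p.1 - A p.2).det.totalDegree := totalDegree_finsetProd _ _
      _ ≤ ∑ _p ∈ pairs, n := by
          refine Finset.sum_le_sum fun p _ => ?_
          have := totalDegree_det_le (A p.1 - A p.2) (hdegA p.1 p.2)
          simpa using this
      _ = pairs.card * n := by rw [Finset.sum_const, smul_eq_mul]
      _ ≤ k.choose 2 * n := Nat.mul_le_mul_right _ hpairs_card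
      _ = n * k.choose 2 := Nat.mul_comm _ _
  -- evaluation of `P`
  have hevalA : ∀ (x : Fin k × C₀ → ZMod 2) u v,
      (MvPolynomial.eval x).mapMatrix (A u - A v) = matOf x u - matOf x v := by
    intro x u v
    ext i j
    simp [hA, hmatOf, Matrix.sub_apply, Matrix.of_apply, Matrix.sum_apply, Matrix.smul_apply,
      RingHom.mapMatrix_apply, Matrix.map_apply, map_sub, map_sum, map_mul, eval_X, eval_C]
  have hevalP : ∀ x : Fin k × C₀ → ZMod 2,
      MvPolynomial.eval x P = ∏ p ∈ pairs, (matOf x p.1 - matOf x p.2).det := by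
    intro x
    rw [hP, map_prod]
    refine Finset.prod_congr rfl fun p _ => ?_
    rw [RingHom.map_det, hevalA]
  -- Step 3: `P` does not vanish identically (`k ≤ 2ⁿ` images of `GF(2ⁿ) ⊂ M_n(GF(2))`).
  have hcard : Fintype.card (Fin n → ZMod 2) = 2 ^ n := by simp
  set w : Fin k → (Fin n → ZMod 2) :=
    fun u => (Fintype.equivFinOfCardEq hcard).symm (Fin.castLE hk u) with hw
  have hw_inj : Function.Injective w := by
    intro u v huv
    simp only [hw, Equiv.apply_eq_iff_eq] at huv
    exact Fin.castLE_injective hk huv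
  set g : Fin k → Matrix (Fin n) (Fin n) (ZMod 2) := fun u => ∑ i, w u i • gfRegRep 2 n hn i with hg
  have hg_unit : ∀ u v, u ≠ v → IsUnit (g u - g v) := by
    intro u v huv
    have hsub : g u - g v = ∑ i, (w u - w v) i • gfRegRep 2 n hn i := by
      simp only [hg, Pi.sub_apply, sub_smul, Finset.sum_sub_distrib]
    rw [hsub]
    exact gfRegRep_isUnit 2 n hn _ (sub_ne_zero.mpr fun h => huv (hw_inj h))
  set x₀ : Fin k × C₀ → ZMod 2 := fun q => e (g q.1) q.2 with hx₀
  have hmat₀ : ∀ u, matOf x₀ u = g u := by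
    intro u
    rw [matOf_eq]
    exact e.symm_apply_apply (g u)
  have hP₀ : MvPolynomial.eval x₀ P ≠ 0 := by
    rw [hevalP]
    refine Finset.prod_ne_zero_iff.mpr fun p hp => ?_
    simp only [hpairs, Finset.mem_filter, Finset.mem_univ, true_and] at hp
    rw [hmat₀, hmat₀]
    exact ((Matrix.isUnit_iff_isUnit_det _).mp (hg_unit _ _ (ne_of_lt hp))).ne_zero
  -- Step 4: a non-root `x'` of small support: `k` matrices with pairwise invertible differences.
  obtain ⟨x', hx'supp, hx'P⟩ := exists_eval_ne_zero_small_support P hP₀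
  set a' : Fin k → Matrix (Fin n) (Fin n) (ZMod 2) := matOf x' with ha'
  have hdet : ∀ p ∈ pairs, (a' p.1 - a' p.2).det ≠ 0 := by
    rw [hevalP] at hx'P
    exact Finset.prod_ne_zero_iff.mp hx'P
  have hunit' : ∀ u v, u ≠ v → IsUnit (a' u - a' v) := by
    intro u v huv
    rw [Matrix.isUnit_iff_isUnit_det, isUnit_iff_ne_zero]
    rcases lt_or_gt_of_ne huv with h | h
    · exact hdet (u, v) (by simp [hpairs, h])
    · have h1 := hdet (v, u) (by simp [hpairs, h])
      rw [← neg_sub, Matrix.det_neg]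
      exact mul_ne_zero (pow_ne_zero _ (by norm_num)) h1
  have hdist : ∀ u v, u ≠ v → n ^ 2 ≤ hammingDist (Γ (a' u)) (Γ (a' v)) := by
    intro u v huv
    rw [hammingDist_eq_hammingNorm, ← map_neg, ← map_add, neg_add_eq_sub]
    exact hΓ.sq_le _ (hunit' v u (Ne.symm huv))
  -- Step 5: the coordinates in `C₀` on which all `a'_u` vanish.
  set J : Finset C₀ := (supp x').image Prod.snd with hJ
  have hJcard : J.card ≤ n * k.choose 2 :=
    (Finset.card_image_le).trans (hx'supp.trans hdegP)
  have hvanish : ∀ c : C₀, c ∉ J → ∀ u, Γ (a' u) c = 0 := by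
    intro c hc u
    rw [ha', e_matOf]
    by_contra hne
    exact hc (Finset.mem_image.mpr ⟨(u, c), mem_supp.mpr hne, rfl⟩)
  set Rset : Finset ι := (Finset.univ.filter fun c : C₀ => c ∉ J).map
    (Function.Embedding.subtype _) with hRset
  have hRset_vanish : ∀ c ∈ Rset, ∀ u, Γ (a' u) c = 0 := by
    intro c hc u
    simp only [hRset, Finset.mem_map, Finset.mem_filter, Finset.mem_univ, true_and,
      Function.Embedding.coe_subtype] at hc
    obtain ⟨c', hc'J, rfl⟩ := hc
    exact hvanish c' hc'J u
  have hRset_card : n * n ≤ Rset.card + n * k.choose 2 := by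
    have h1 : Rset.card = (Finset.univ.filter fun c : C₀ => c ∉ J).card := Finset.card_map _
    have h2 : (Finset.univ.filter fun c : C₀ => c ∈ J).card = J.card := by
      congr 1
      ext c
      simp
    have h3 := Finset.card_filter_add_card_filter_not (s := (Finset.univ : Finset C₀)) (fun c => c ∈ J)
    rw [h2, Finset.card_univ, Fintype.card_coe, hC₀] at h3
    omega
  -- Step 6: Plotkin on the remaining coordinates.
  set words : Fin k → {c : ι // c ∉ Rset} → ZMod 2 := fun u c => Γ (a' u) c with hwords
  have hwords_dist : ∀ u v, u ≠ v → n ^ 2 ≤ hammingDist (words u) (words v) := by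
    intro u v huv
    refine (hdist u v huv).trans (le_of_eq ?_)
    simp only [hammingDist, hwords]
    have hset : (Finset.univ.filter fun x : {c : ι // c ∉ Rset} => Γ (a' u) x ≠ Γ (a' v) x)
        = (Finset.univ.filter fun c : ι => Γ (a' u) c ≠ Γ (a' v) c).subtype (fun c => c ∉ Rset) := by
      ext x
      simp only [Finset.mem_filter, Finset.mem_univ, true_and, Finset.mem_subtype]
    rw [hset, Finset.card_subtype, Finset.filter_filter]
    congr 1
    ext c
    simp only [Finset.mem_filter, Finset.mem_univ, true_and]
    constructor
    · intro h
      refine ⟨h, fun hc => h ?_⟩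
      rw [hRset_vanish c hc u, hRset_vanish c hc v]
    · intro h
      exact h.1
  have hplotkin := plotkin_binary words (N := n ^ 2) (by simpa using hk2)
    (fun u v huv => hwords_dist u v huv)
  rw [Fintype.card_fin] at hplotkin
  have hT : Fintype.card {c : ι // c ∉ Rset} + Rset.card = Fintype.card ι := by
    have h1 : Fintype.card {c : ι // c ∉ Rset} = (Finset.univ.filter fun c : ι => c ∉ Rset).card :=
      Fintype.card_subtype _
    have h2 : (Finset.univ.filter fun c : ι => c ∈ Rset).card = Rset.card := by
      congr 1
      ext c
      simp
    have h3 := Finset.card_filter_add_card_filter_not (s := (Finset.univ : Finset ι)) (fun c => c ∈ Rset)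
    rw [h2, Finset.card_univ] at h3
    omega
  -- Step 7: arithmetic.
  have h32 : 3 * k - 2 = 2 * (k - 1) + k := by omega
  have hkR := Nat.mul_le_mul_left k hRset_card
  rw [h32, Nat.add_mul, ← hT, Nat.mul_add]
  have : k * (n * n) = k * n ^ 2 := by ring
  nlinarith [hplotkin, hkR, this]

/-! ## Theorem 1: the bilinear rank of `⟨n,n,n⟩` over `𝔽₂` -/

/-- **Lemma (Shpilka 2003, Lemma 7), in the form used.** For a bilinear computation
`xy = ∑_i μ_i(x) η_i(y) w_i` of `⟨n,n,n⟩` over `𝔽₂`, the first code map `Γ(x) = (μ_i(x))_i`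
(`BilinComp.code₁`, Brockett–Dobkin's `γ₁`) is one-to-one and has weight `≥ n²` at every invertible `x`
(printed: «for every matrix `x ∈ M_n`, `weight(Γ(x)) ≥ n · rank(x)`» — «`x · y` is a function of
`η_1(y), …, η_k(y)` … there are exactly `2^{nr}` different matrices of the form `x · y`»; here via
`dim {x y : y} ≤ weight`, BCS Thm. (18.4), at invertible `x` where `{x y : y}` is everything).
[cite: Shpilka2003, Lemma 7] -/
theorem isMatrixCode_code₁ {n : ℕ} {ι : Type*} [Fintype ι]
    (β : BilinComp (mulBilin (ZMod 2) n n n) ι) : IsMatrixCode n β.code₁ := by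
  classical
  refine ⟨β.code₁_injective fun x hx => ?_, fun x hx => ?_⟩
  · have h := LinearMap.congr_fun hx 1
    simpa using h
  · obtain ⟨u, rfl⟩ := hx
    have htop : LinearMap.range (mulBilin (ZMod 2) n n n (u : Matrix (Fin n) (Fin n) (ZMod 2))) = ⊤ := by
      refine LinearMap.range_eq_top.2 fun z => ⟨(↑u⁻¹ : Matrix (Fin n) (Fin n) (ZMod 2)) * z, ?_⟩
      simp [← mul_assoc]
    have h := β.finrank_range_le_hammingNorm_code₁ (u : Matrix (Fin n) (Fin n) (ZMod 2))
    rw [htop, finrank_top] at h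
    simpa [Module.finrank_matrix, sq] using h


/-- `n · rank(x) ≤ dim {x·y : y}`: every matrix whose columns lie in the column space of `x` is of the
form `x·y` («Since `rank(x) = r` we get that there are exactly `2^{nr}` different matrices of the form
`x · y`»). [cite: Shpilka2003, Lemma 7 (proof)] -/
theorem Shpilka2003.mul_rank_le_finrank_range_mul {K : Type*} [Field K] {n : ℕ}
    (x : Matrix (Fin n) (Fin n) K) :
    n * x.rank ≤ finrank K (LinearMap.range (mulBilin K n n n x)) := by
  classical
  set C := LinearMap.range x.mulVecLin with hC
  have hsurj : LinearMap.range (x.mulVecLin.rangeRestrict) = ⊤ := LinearMap.range_rangeRestrict _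
  obtain ⟨g, hg⟩ := LinearMap.exists_rightInverse_of_surjective _ hsurj
  have hsec : ∀ c : C, x *ᵥ (g c) = (c : Fin n → K) := by
    intro c
    have := LinearMap.congr_fun hg c
    simp only [LinearMap.comp_apply, LinearMap.id_apply] at this
    have h2 := congrArg Subtype.val this
    simpa using h2
  set Ψ : (Fin n → C) →ₗ[K] Matrix (Fin n) (Fin n) K :=
    { toFun := fun c => Matrix.of fun i j => ((c j : C) : Fin n → K) i
      map_add' := fun c c' => by ext i j; simp
      map_smul' := fun a c => by ext i j; simp } with hΨ
  have hΨinj : Function.Injective Ψ := by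
    intro c c' h
    funext j
    apply Subtype.ext
    funext i
    have := congrFun (congrFun h i) j
    simpa [hΨ] using this
  have hΨle : LinearMap.range Ψ ≤ LinearMap.range (mulBilin K n n n x) := by
    rintro _ ⟨c, rfl⟩
    refine ⟨Matrix.of fun l j => g (c j) l, ?_⟩
    ext i j
    simp only [mulBilin_apply, hΨ, LinearMap.coe_mk, AddHom.coe_mk, Matrix.of_apply]
    have := congrFun (hsec (c j)) i
    rw [← this]
    simp [Matrix.mul_apply, Matrix.mulVec, dotProduct]
  calc n * x.rank = finrank K (Fin n → C) := by
        rw [Module.finrank_pi_fintype, Finset.sum_const, Finset.card_univ, Fintype.card_fin,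
          smul_eq_mul]
        rfl
    _ = finrank K (LinearMap.range Ψ) := (LinearMap.finrank_range_of_inj hΨinj).symm
    _ ≤ finrank K (LinearMap.range (mulBilin K n n n x)) := Submodule.finrank_mono hΨle

/-- **Lemma (Shpilka 2003, Lemma 7), as printed:** for every bilinear computation of `⟨n,n,n⟩` over
`𝔽₂`, `Γ(x) = (μ_i(x))_i` is a linear code of matrices — «for every matrix `x ∈ M_n`,
`weight(Γ(x)) ≥ n · rank(x)`» (the products with `μ_i(x) = 0` contribute nothing, so the
`n·rank(x)`-dimensional space `{x·y}` is spanned by the remaining `w_i`). [cite: Shpilka2003, Lemma 7] -/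
theorem isLinearCodeOfMatrices_code₁ {n : ℕ} {ι : Type*} [Fintype ι]
    (β : BilinComp (mulBilin (ZMod 2) n n n) ι) : IsLinearCodeOfMatrices n β.code₁ := fun x =>
  (Shpilka2003.mul_rank_le_finrank_range_mul x).trans (β.finrank_range_le_hammingNorm_code₁ x)

/-- **Theorem (Shpilka 2003, Thm. 1) for a computation of length `|ι|`, explicit form:** every bilinear
computation of `⟨n,n,n⟩` over `𝔽₂` with `|ι|` products satisfies `(3k − 2)·n² ≤ k·|ι| + k·n·C(k,2)`
for all `2 ≤ k ≤ 2ⁿ`. [cite: Shpilka2003, Thm. 1 (proof, §4.2)] -/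
theorem shpilka2003_thm1_bilinComp {n : ℕ} (hn : n ≠ 0) {ι : Type*} [Fintype ι] [DecidableEq ι]
    (β : BilinComp (mulBilin (ZMod 2) n n n) ι) {k : ℕ} (hk2 : 2 ≤ k) (hk : k ≤ 2 ^ n) :
    (3 * k - 2) * n ^ 2 ≤ k * Fintype.card ι + k * (n * k.choose 2) :=
  shpilka2003_thm3 hn (isMatrixCode_code₁ β) hk2 hk

/-- **Theorem (Shpilka 2003, Thm. 1), explicit form.** «`s_bl ≥ 3n² − O(n^{5/3})` (in other words
`R_{GF(2)}(MP_n) ≥ 3n² − O(n^{5/3})`).» Here: for every `n ≥ 1` and `2 ≤ k ≤ 2ⁿ`,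
`(3k − 2)·n² ≤ k·R_{𝔽₂}(⟨n,n,n⟩) + k·n·C(k,2)`, i.e. `R_{𝔽₂}(⟨n,n,n⟩) ≥ 3n² − 2n²/k − n·C(k,2)`
(`k ≈ n^{1/3}` gives the printed form). [cite: Shpilka2003, Thm. 1] -/
theorem shpilka2003_thm1 {n : ℕ} (hn : n ≠ 0) {k : ℕ} (hk2 : 2 ≤ k) (hk : k ≤ 2 ^ n) :
    (3 * k - 2) * n ^ 2 ≤
      k * tensorRank (matMulTensor (ZMod 2) n n n) + k * (n * k.choose 2) := by
  classical
  obtain ⟨β⟩ := exists_bilinComp_of_tensorRank_le (k := ZMod 2) (c := n) (m := n) (n := n) le_rfl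
  have h := shpilka2003_thm1_bilinComp hn β hk2 hk
  simpa using h

/-- `n = 3`, `k = 2`: Shpilka's chain gives only `15 ≤ R_{𝔽₂}(⟨3,3,3⟩)` (`36 ≤ 2R + 6`) — below the
tree's `17` (`seventeen_le_tensorRank_matMulTensor_three_F2_viaCodes`), `19` (`blaser2003_cor9_holds`)
and `20` (`Wang2026_thm1`): the theorem is asymptotic and vacuous for `3 × 3`.
[cite: Shpilka2003, Thm. 1] -/
theorem fifteen_le_tensorRank_matMulTensor_three_F2_viaShpilka :
    15 ≤ tensorRank (matMulTensor (ZMod 2) 3 3 3) := by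
  have h := shpilka2003_thm1 (n := 3) (by norm_num) (k := 2) le_rfl (by norm_num)
  have h2 : (2 : ℕ).choose 2 = 1 := by decide
  rw [h2] at h
  norm_num at h
  omega

/-- `n = 128`, `k = 6`: `41771 ≤ R_{𝔽₂}(⟨128,128,128⟩)` (`16·128² ≤ 6R + 6·128·15`), above Bläser's
any-field `(5/2)·128² − 3·128 = 40576` — the `𝔽₂`-specific improvement «over [Bshouty89, Blaser99]
who proved lower bounds of `2.5n² − o(n²)`», in numbers. [cite: Shpilka2003, Thm. 1, §1.3] -/
theorem shpilka2003_thm1_n128 :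
    41771 ≤ tensorRank (matMulTensor (ZMod 2) 128 128 128) := by
  have h := shpilka2003_thm1 (n := 128) (by norm_num) (k := 6) (by norm_num) (by norm_num)
  have h2 : (6 : ℕ).choose 2 = 15 := by decide
  rw [h2] at h
  norm_num at h
  omega

end Codes


/-! ## Theorem 2: quadratic circuits (the commutative model) over `𝔽₂` -/

section QuadraticGeneral

open Module Finset

variable {K : Type*} [Field K]
variable {U V W : Type*} [AddCommGroup U] [Module K U] [AddCommGroup V] [Module K V]
  [AddCommGroup W] [Module K W]

namespace Shpilka2003

/-- The left partial-derivative functionals of the bilinear form `λ ∘ φ`: `e ↦ ((x, y) ↦ λ(φ(e, y)))`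
(«`∂/∂x_{i,j} trace(x·y·z₀ᵗ)`»). [cite: Shpilka2003, Lemma 8 (proof)] -/
def lDer (φ : U →ₗ[K] V →ₗ[K] W) (l : Dual K W) : U →ₗ[K] Dual K (U × V) :=
  (LinearMap.snd K U V).dualMap ∘ₗ (φ.compr₂ l)

/-- The right partial-derivative functionals: `e' ↦ ((x, y) ↦ λ(φ(x, e')))`.
[cite: Shpilka2003, Lemma 8 (proof)] -/
def rDer (φ : U →ₗ[K] V →ₗ[K] W) (l : Dual K W) : V →ₗ[K] Dual K (U × V) :=
  (LinearMap.fst K U V).dualMap ∘ₗ (φ.flip.compr₂ l)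

/-- `lDer φ λ e (x, y) = λ(φ(e, y))`. [cite: Shpilka2003, Lemma 8 (proof)] -/
@[simp] theorem lDer_apply (φ : U →ₗ[K] V →ₗ[K] W) (l : Dual K W) (e : U) (p : U × V) :
    lDer φ l e p = l (φ e p.2) := rfl

/-- `rDer φ λ e' (x, y) = λ(φ(x, e'))`. [cite: Shpilka2003, Lemma 8 (proof)] -/
@[simp] theorem rDer_apply (φ : U →ₗ[K] V →ₗ[K] W) (l : Dual K W) (e : V) (p : U × V) :
    rDer φ l e p = l (φ p.1 e) := rfl

variable {φ : U →ₗ[K] V →ₗ[K] W} {ι : Type*} [Fintype ι]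

/-- `λ ∘ φ` written through the computation: `λ(φ(u,v)) = ∑_t λ(w_t) f_t(u,v) g_t(u,v)`.
[cite: Shpilka2003, Lemma 8 (proof), eq. (trace_eq)] -/
private theorem apply_map_eq_sum (q : QuadComp φ ι) (l : Dual K W) (u : U) (v : V) :
    l (φ u v) = ∑ t, l (q.w t) * (q.f t (u, v) * q.g t (u, v)) := by
  rw [q.map_eq_sum]
  simp only [map_sum, map_smul, smul_eq_mul]
  exact Finset.sum_congr rfl fun t _ => by ring

/-- The discrete derivative in the direction `(e, 0)`: the functional `(x, y) ↦ λ(φ(e, y))` is the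
combination `∑_t λ(w_t) (f_t(e,0) g_t + g_t(e,0) f_t)` («`(z₀ yᵗ)_{i,j} = ∑ (μ_i(e,0) η_i(x,y) +
μ_i(x,y) η_i(e,0))`»). [cite: Shpilka2003, Lemma 8 (proof)] -/
theorem lDer_eq_sum (q : QuadComp φ ι) (l : Dual K W) (e : U) :
    lDer φ l e = ∑ t, ((l (q.w t) * q.f t (e, 0)) • q.g t + (l (q.w t) * q.g t (e, 0)) • q.f t) := by
  apply LinearMap.ext
  rintro ⟨x, y⟩
  simp only [lDer_apply, LinearMap.coe_sum, Finset.sum_apply, LinearMap.add_apply,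
    LinearMap.smul_apply, smul_eq_mul]
  have h1 : l (φ e y) = l (φ (x + e) y) - l (φ x y) := by simp [map_add]
  have h2 : ∀ t, q.f t (x + e, y) = q.f t (x, y) + q.f t (e, 0) := by
    intro t; rw [← map_add]; simp
  have h3 : ∀ t, q.g t (x + e, y) = q.g t (x, y) + q.g t (e, 0) := by
    intro t; rw [← map_add]; simp
  have hK : ∑ t, l (q.w t) * (q.f t (e, 0) * q.g t (e, 0)) = 0 := by
    rw [← apply_map_eq_sum]; simp
  rw [h1, apply_map_eq_sum q, apply_map_eq_sum q, ← Finset.sum_sub_distrib]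
  have hterm : ∀ t, l (q.w t) * (q.f t (x + e, y) * q.g t (x + e, y)) -
      l (q.w t) * (q.f t (x, y) * q.g t (x, y)) =
      (l (q.w t) * q.f t (e, 0) * q.g t (x, y) + l (q.w t) * q.g t (e, 0) * q.f t (x, y)) +
        l (q.w t) * (q.f t (e, 0) * q.g t (e, 0)) := by
    intro t; rw [h2, h3]; ring
  rw [Finset.sum_congr rfl fun t _ => hterm t, Finset.sum_add_distrib, hK, add_zero]

/-- Symmetrically for the direction `(0, e')`. [cite: Shpilka2003, Lemma 8 (proof)] -/
theorem rDer_eq_sum (q : QuadComp φ ι) (l : Dual K W) (e : V) :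
    rDer φ l e = ∑ t, ((l (q.w t) * q.f t (0, e)) • q.g t + (l (q.w t) * q.g t (0, e)) • q.f t) := by
  apply LinearMap.ext
  rintro ⟨x, y⟩
  simp only [rDer_apply, LinearMap.coe_sum, Finset.sum_apply, LinearMap.add_apply,
    LinearMap.smul_apply, smul_eq_mul]
  have h1 : l (φ x e) = l (φ x (y + e)) - l (φ x y) := by simp [map_add]
  have h2 : ∀ t, q.f t (x, y + e) = q.f t (x, y) + q.f t (0, e) := by
    intro t; rw [← map_add]; simp
  have h3 : ∀ t, q.g t (x, y + e) = q.g t (x, y) + q.g t (0, e) := by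
    intro t; rw [← map_add]; simp
  have hK : ∑ t, l (q.w t) * (q.f t (0, e) * q.g t (0, e)) = 0 := by
    rw [← apply_map_eq_sum]; simp
  rw [h1, apply_map_eq_sum q, apply_map_eq_sum q, ← Finset.sum_sub_distrib]
  have hterm : ∀ t, l (q.w t) * (q.f t (x, y + e) * q.g t (x, y + e)) -
      l (q.w t) * (q.f t (x, y) * q.g t (x, y)) =
      (l (q.w t) * q.f t (0, e) * q.g t (x, y) + l (q.w t) * q.g t (0, e) * q.f t (x, y)) +
        l (q.w t) * (q.f t (0, e) * q.g t (0, e)) := by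
    intro t; rw [h2, h3]; ring
  rw [Finset.sum_congr rfl fun t _ => hterm t, Finset.sum_add_distrib, hK, add_zero]

/-- The two families of partial derivatives meet trivially (a functional depending only on `y` and
one depending only on `x` that agree vanish). [cite: Shpilka2003, Lemma 8 (proof), eq. (spangeq)] -/
theorem range_lDer_inf_range_rDer (φ : U →ₗ[K] V →ₗ[K] W) (l : Dual K W) :
    LinearMap.range (lDer φ l) ⊓ LinearMap.range (rDer φ l) = ⊥ := by
  rw [Submodule.eq_bot_iff]
  rintro F ⟨⟨e, rfl⟩, ⟨e', he'⟩⟩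
  apply LinearMap.ext
  rintro ⟨x, y⟩
  have h0 := LinearMap.congr_fun he' (x, (0 : V))
  have h1 := LinearMap.congr_fun he' (x, y)
  simp only [rDer_apply, lDer_apply, map_zero] at h0 h1
  simp only [lDer_apply, LinearMap.zero_apply]
  rw [← h1, h0]

/-- **Lemma (Shpilka 2003, Lemma 8), general form of the dimension count.** For a quadratic computation
`φ(u,v) = ∑_t f_t(u,v) g_t(u,v) w_t` of a BILINEAR map `φ` and a functional `λ`: the left and right
partial-derivative functionals of `λ ∘ φ` lie in `span{f_t, g_t : λ(w_t) ≠ 0}` (dimension `≤ 2k`), and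
span a space of dimension `rank_left(λ∘φ) + rank_right(λ∘φ)`; hence
`dim{λ(φ(e,·))} + dim{λ(φ(·,e'))} ≤ 2·#{t : λ(w_t) ≠ 0}` («Combining equations (spanleq) and (spangeq)
we get that `2k ≥ 2nr`»). [cite: Shpilka2003, Lemma 8] -/
theorem finrank_add_finrank_le_two_mul_card [FiniteDimensional K U] [FiniteDimensional K V]
    [DecidableEq K] (q : QuadComp φ ι) (l : Dual K W) :
    finrank K (LinearMap.range (φ.compr₂ l)) + finrank K (LinearMap.range (φ.flip.compr₂ l)) ≤
      2 * #{t | l (q.w t) ≠ 0} := by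
  classical
  set S : Finset ι := Finset.univ.filter fun t => l (q.w t) ≠ 0 with hS
  set D : Submodule K (Dual K (U × V)) :=
    Submodule.span K ((S.image q.f ∪ S.image q.g : Finset (Dual K (U × V))) : Set (Dual K (U × V)))
    with hD
  -- dim D ≤ 2 |S|
  have hDfin : finrank K D ≤ 2 * S.card := by
    calc finrank K D ≤ (S.image q.f ∪ S.image q.g).card := finrank_span_finset_le_card _
      _ ≤ (S.image q.f).card + (S.image q.g).card := Finset.card_union_le _ _
      _ ≤ S.card + S.card := Nat.add_le_add Finset.card_image_le Finset.card_image_le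
      _ = 2 * S.card := by ring
  -- the derivative functionals lie in D
  have hmem : ∀ (a b : ι → K), (∑ t, (((l (q.w t) * a t) • q.g t + (l (q.w t) * b t) • q.f t))) ∈ D := by
    intro a b
    refine Submodule.sum_mem _ fun t _ => ?_
    by_cases ht : l (q.w t) = 0
    · simp [ht]
    · have htS : t ∈ S := by simp [hS, ht]
      refine Submodule.add_mem _ (Submodule.smul_mem _ _ ?_) (Submodule.smul_mem _ _ ?_)
      · exact Submodule.subset_span (by simp; exact Or.inr ⟨t, htS, rfl⟩)
      · exact Submodule.subset_span (by simp; exact Or.inl ⟨t, htS, rfl⟩)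
  have hL : LinearMap.range (lDer φ l) ≤ D := by
    rintro _ ⟨e, rfl⟩
    rw [lDer_eq_sum q]
    exact hmem (fun t => q.f t (e, 0)) (fun t => q.g t (e, 0))
  have hR : LinearMap.range (rDer φ l) ≤ D := by
    rintro _ ⟨e, rfl⟩
    rw [rDer_eq_sum q]
    exact hmem (fun t => q.f t (0, e)) (fun t => q.g t (0, e))
  -- dimensions
  have hsup := Submodule.finrank_sup_add_finrank_inf_eq (LinearMap.range (lDer φ l))
    (LinearMap.range (rDer φ l))
  rw [range_lDer_inf_range_rDer, finrank_bot, add_zero] at hsup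
  have hle : finrank K ↥(LinearMap.range (lDer φ l) ⊔ LinearMap.range (rDer φ l)) ≤ finrank K D :=
    Submodule.finrank_mono (sup_le hL hR)
  -- `lDer`/`rDer` are injective images of the `compr₂` ranges
  have hinjL : Function.Injective ((LinearMap.snd K U V).dualMap) := by
    intro f g h
    apply LinearMap.ext fun v => ?_
    have := LinearMap.congr_fun h ((0 : U), v)
    simpa using this
  have hinjR : Function.Injective ((LinearMap.fst K U V).dualMap) := by
    intro f g h
    apply LinearMap.ext fun u => ?_
    have := LinearMap.congr_fun h (u, (0 : V))
    simpa using this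
  have hL' : finrank K (LinearMap.range (lDer φ l)) = finrank K (LinearMap.range (φ.compr₂ l)) := by
    rw [lDer, LinearMap.range_comp]
    exact (LinearEquiv.finrank_eq (Submodule.equivMapOfInjective _ hinjL _)).symm
  have hR' : finrank K (LinearMap.range (rDer φ l)) = finrank K (LinearMap.range (φ.flip.compr₂ l)) := by
    rw [rDer, LinearMap.range_comp]
    exact (LinearEquiv.finrank_eq (Submodule.equivMapOfInjective _ hinjR _)).symm
  rw [← hL', ← hR', ← hsup]
  exact hle.trans hDfin

end Shpilka2003

end QuadraticGeneral

section QuadraticMatMul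

open Module Matrix Finset Shpilka2003

variable {K : Type*} [Field K] {n : ℕ}

/-- The Frobenius pairing `⟨z, w⟩ = ∑_{i,j} z_{ij} w_{ij} = trace(w·zᵗ)` as a bilinear map (Shpilka's
`γ_k(z) = ∑_{i,j} α^{(k)}_{i,j} z_{i,j}`). [cite: Shpilka2003, §4.3] -/
def Shpilka2003.frob (n : ℕ) :
    Matrix (Fin n) (Fin n) K →ₗ[K] Matrix (Fin n) (Fin n) K →ₗ[K] K :=
  LinearMap.mk₂ K (fun z w => ∑ i, ∑ j, z i j * w i j)
    (fun z z' w => by simp only [Matrix.add_apply, add_mul, Finset.sum_add_distrib])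
    (fun c z w => by simp only [Matrix.smul_apply, smul_eq_mul, mul_assoc, Finset.mul_sum])
    (fun z w w' => by simp only [Matrix.add_apply, mul_add, Finset.sum_add_distrib])
    (fun c z w => by simp only [Matrix.smul_apply, smul_eq_mul, Finset.mul_sum, mul_left_comm])

/-- `frob z w = ∑ z_{ij} w_{ij}`. [cite: Shpilka2003, §4.3] -/
@[simp] theorem Shpilka2003.frob_apply (z w : Matrix (Fin n) (Fin n) K) :
    Shpilka2003.frob n z w = ∑ i, ∑ j, z i j * w i j := rfl

/-- the matrix unit `E_{ab}` (Shpilka: «Let `e_{i,j}` be the matrix of all zeros but 1 in the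
`(i,j)`'th place»). [folklore] -/
private def unitMat (a b : Fin n) : Matrix (Fin n) (Fin n) K :=
  Matrix.of fun i j => if i = a ∧ j = b then 1 else 0

/-- `⟨z, E_{ab}⟩ = z_{ab}`. [folklore] -/
private theorem frob_unitMat (z : Matrix (Fin n) (Fin n) K) (a b : Fin n) :
    Shpilka2003.frob n z (unitMat a b) = z a b := by
  simp only [Shpilka2003.frob_apply, unitMat, Matrix.of_apply, mul_ite, mul_one, mul_zero]
  rw [Finset.sum_eq_single a, Finset.sum_eq_single b]
  · simp
  · intro j _ hj; simp [hj]
  · simp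
  · intro i _ hi; exact Finset.sum_eq_zero fun j _ => by simp [hi]
  · simp

/-- `⟨z, x·E_{ab}⟩ = (xᵀ z)_{ab}`. [folklore] -/
private theorem frob_mul_unitMat (z x : Matrix (Fin n) (Fin n) K) (a b : Fin n) :
    Shpilka2003.frob n z (x * unitMat a b) = (xᵀ * z) a b := by
  simp only [Shpilka2003.frob_apply, Matrix.mul_apply, unitMat, Matrix.of_apply, Matrix.transpose_apply,
    mul_ite, mul_one, mul_zero]
  -- ∑ i ∑ j z i j * ∑ l, (if l = a ∧ j = b then x i l else 0) = ∑ i, x i a * z i b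
  have hin : ∀ i j, (∑ l, if l = a ∧ j = b then x i l else 0) = if j = b then x i a else 0 := by
    intro i j
    by_cases hj : j = b
    · rw [if_pos hj, Finset.sum_eq_single a]
      · simp [hj]
      · intro l _ hl; simp [hl]
      · simp
    · rw [if_neg hj]; exact Finset.sum_eq_zero fun l _ => by simp [hj]
  simp_rw [hin, mul_ite, mul_zero]
  refine Finset.sum_congr rfl fun i _ => ?_
  rw [Finset.sum_ite_eq' Finset.univ b]
  simp [mul_comm]

/-- `⟨z, E_{ab}·y⟩ = (z yᵀ)_{ab}`. [folklore] -/
private theorem frob_unitMat_mul (z y : Matrix (Fin n) (Fin n) K) (a b : Fin n) :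
    Shpilka2003.frob n z (unitMat a b * y) = (z * yᵀ) a b := by
  simp only [Shpilka2003.frob_apply, Matrix.mul_apply, unitMat, Matrix.of_apply, Matrix.transpose_apply,
    ite_mul, one_mul, zero_mul]
  have hin : ∀ i j, (∑ l, if i = a ∧ l = b then y l j else 0) = if i = a then y b j else 0 := by
    intro i j
    by_cases hi : i = a
    · rw [if_pos hi, Finset.sum_eq_single b]
      · simp [hi]
      · intro l _ hl; simp [hl]
      · simp
    · rw [if_neg hi]; exact Finset.sum_eq_zero fun l _ => by simp [hi]
  simp_rw [hin, mul_ite, mul_zero]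
  rw [Finset.sum_eq_single a]
  · simp
  · intro i _ hi; exact Finset.sum_eq_zero fun j _ => by simp [hi]
  · simp

/-- **The third code of a quadratic computation of `⟨n,n,n⟩`** (Shpilka §4.3: «define a linear mapping
`Γ : M_n(𝔽₂) → {0,1}^m` by `Γ(z) = (γ_1(z), …, γ_m(z))`», `γ_t(z) = ⟨z, w_t⟩`).
[cite: Shpilka2003, §4.3 (definition of `Γ`)] -/
def QuadComp.code₃Mat {ι : Type*} [Fintype ι] (q : QuadComp (mulBilin K n n n) ι) :
    Matrix (Fin n) (Fin n) K →ₗ[K] (ι → K) :=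
  LinearMap.pi fun t => (Shpilka2003.frob n).flip (q.w t)

/-- `code₃Mat q z t = ⟨z, w_t⟩`. [cite: Shpilka2003, §4.3] -/
@[simp] theorem QuadComp.code₃Mat_apply {ι : Type*} [Fintype ι] (q : QuadComp (mulBilin K n n n) ι)
    (z : Matrix (Fin n) (Fin n) K) (t : ι) :
    q.code₃Mat z t = Shpilka2003.frob n z (q.w t) := rfl

/-- **Lemma (Shpilka 2003, Lemma 8), for `𝔽₂`, in the form used:** the third code of a quadratic
computation of `⟨n,n,n⟩` is one-to-one and has weight `≥ n²` at invertible `z` («`Γ` is a linear mapping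
and it has the property that for every matrix `z`, `weight(Γ(z)) ≥ n · rank(z)`»).
[cite: Shpilka2003, Lemma 8] -/
theorem isMatrixCode_code₃Mat {ι : Type*} [Fintype ι] (q : QuadComp (mulBilin (ZMod 2) n n n) ι) :
    IsMatrixCode n q.code₃Mat := by
  classical
  have hsum : ∀ (z x y : Matrix (Fin n) (Fin n) (ZMod 2)),
      Shpilka2003.frob n z (x * y) = ∑ t, Shpilka2003.frob n z (q.w t) * (q.f t (x, y) * q.g t (x, y)) := by
    intro z x y
    have := Shpilka2003.apply_map_eq_sum q ((Shpilka2003.frob n) z) x y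
    simpa using this
  refine ⟨(injective_iff_map_eq_zero _).2 fun z hz => ?_, fun z hz => ?_⟩
  · ext a b
    have h0 : ∀ t, Shpilka2003.frob n z (q.w t) = 0 := fun t => by
      simpa using congrFun hz t
    have h1 := hsum z 1 (unitMat a b)
    rw [one_mul, frob_unitMat] at h1
    rw [h1]
    exact Finset.sum_eq_zero fun t _ => by rw [h0 t, zero_mul]
  · -- weight ≥ n²: the dimension count of Lemma 8 with both partial maps injective
    set l : Dual (ZMod 2) (Matrix (Fin n) (Fin n) (ZMod 2)) := Shpilka2003.frob n z with hl
    have hcount := Shpilka2003.finrank_add_finrank_le_two_mul_card q l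
    obtain ⟨u, rfl⟩ := hz
    -- left map `x ↦ (y ↦ ⟨z, xy⟩)` is injective: `⟨z, x E_{ab}⟩ = (xᵀ z)_{ab}`
    have hinjL : Function.Injective ((mulBilin (ZMod 2) n n n).compr₂ l) := by
      refine (injective_iff_map_eq_zero _).2 fun x hx => ?_
      have hxz : xᵀ * (u : Matrix (Fin n) (Fin n) (ZMod 2)) = 0 := by
        ext a b
        have := LinearMap.congr_fun hx (unitMat a b)
        simp only [LinearMap.compr₂_apply, mulBilin_apply, LinearMap.zero_apply, hl] at this
        rw [frob_mul_unitMat] at this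
        simpa using this
      have : xᵀ = 0 := by
        calc xᵀ = xᵀ * (u : Matrix (Fin n) (Fin n) (ZMod 2)) * (↑u⁻¹ : Matrix (Fin n) (Fin n) (ZMod 2)) := by
              rw [Units.mul_inv_cancel_right]
          _ = 0 := by rw [hxz, zero_mul]
      simpa using congrArg Matrix.transpose this
    have hinjR : Function.Injective ((mulBilin (ZMod 2) n n n).flip.compr₂ l) := by
      refine (injective_iff_map_eq_zero _).2 fun y hy => ?_
      have hzy : (u : Matrix (Fin n) (Fin n) (ZMod 2)) * yᵀ = 0 := by
        ext a b
        have := LinearMap.congr_fun hy (unitMat a b)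
        simp only [LinearMap.compr₂_apply, LinearMap.flip_apply, mulBilin_apply, LinearMap.zero_apply,
          hl] at this
        rw [frob_unitMat_mul] at this
        simpa using this
      have : yᵀ = 0 := by
        calc yᵀ = (↑u⁻¹ : Matrix (Fin n) (Fin n) (ZMod 2)) * ((u : Matrix (Fin n) (Fin n) (ZMod 2)) * yᵀ) := by
              rw [Units.inv_mul_cancel_left]
          _ = 0 := by rw [hzy, mul_zero]
      simpa using congrArg Matrix.transpose this
    rw [LinearMap.finrank_range_of_inj hinjL, LinearMap.finrank_range_of_inj hinjR] at hcount
    simp only [Module.finrank_matrix, Fintype.card_fin, Module.finrank_self, mul_one] at hcount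
    have hw : hammingNorm (q.code₃Mat (u : Matrix (Fin n) (Fin n) (ZMod 2))) = #{t | l (q.w t) ≠ 0} := by
      simp [hammingNorm, hl]
    rw [hw, sq]
    omega

/-- **Theorem (Shpilka 2003, Thm. 2) for a quadratic computation of length `|ι|`, explicit form:**
every quadratic computation (commutative / quadratic-circuit model) of `⟨n,n,n⟩` over `𝔽₂` with `|ι|`
products satisfies `(3k − 2)·n² ≤ k·|ι| + k·n·C(k,2)` for all `2 ≤ k ≤ 2ⁿ`.
[cite: Shpilka2003, Thm. 2 (proof, §4.3)] -/
theorem shpilka2003_thm2_quadComp (hn : n ≠ 0) {ι : Type*} [Fintype ι] [DecidableEq ι]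
    (q : QuadComp (mulBilin (ZMod 2) n n n) ι) {k : ℕ} (hk2 : 2 ≤ k) (hk : k ≤ 2 ^ n) :
    (3 * k - 2) * n ^ 2 ≤ k * Fintype.card ι + k * (n * k.choose 2) :=
  shpilka2003_thm3 hn (isMatrixCode_code₃Mat q) hk2 hk

/-- **Theorem (Shpilka 2003, Thm. 2), explicit form.** «`s_q ≥ 3n² − O(n^{5/3})`. I.e. the number of
product gates in any quadratic circuit that computes the product of two `n × n` matrices over `GF(2)` is
at least `3n² − O(n^{5/3})`.» Here, with the tree's multiplicative complexity `L = mulComplexity`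
(shortest quadratic computation, BCS (14.2)/(14.4)): for `n ≥ 1` and `2 ≤ k ≤ 2ⁿ`,
`(3k − 2)·n² ≤ k·L_{𝔽₂}(⟨n,n,n⟩) + k·n·C(k,2)`. [cite: Shpilka2003, Thm. 2] -/
theorem shpilka2003_thm2 (hn : n ≠ 0) {k : ℕ} (hk2 : 2 ≤ k) (hk : k ≤ 2 ^ n) :
    (3 * k - 2) * n ^ 2 ≤
      k * mulComplexity (mulBilin (ZMod 2) n n n) + k * (n * k.choose 2) := by
  classical
  obtain ⟨β⟩ := exists_bilinComp_of_tensorRank_le (k := ZMod 2) (c := n) (m := n) (n := n) le_rfl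
  obtain ⟨q⟩ := nonempty_quadComp_mulComplexity β.toQuadComp
  have h := shpilka2003_thm2_quadComp hn q hk2 hk
  simpa using h

/-- `n = 128`, `k = 6`, COMMUTATIVE model: `41771 ≤ L_{𝔽₂}(⟨128,128,128⟩)` — against the any-field
`2n² + n − 3 = 32893` (Bläser 1999, for the multiplicative complexity) and `2n² − 1 = 32767`
(Lafon–Winograd); the same number as the bilinear instance since the explicit bound is the same.
[cite: Shpilka2003, Thm. 2, §1.1] -/
theorem shpilka2003_thm2_n128 :
    41771 ≤ mulComplexity (mulBilin (ZMod 2) 128 128 128) := by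
  have h := shpilka2003_thm2 (n := 128) (by norm_num) (k := 6) (by norm_num) (by norm_num)
  have h2 : (6 : ℕ).choose 2 = 15 := by decide
  rw [h2] at h
  norm_num at h
  omega

end QuadraticMatMul


/-! ## Lemma 8 as printed: `weight(Γ(z)) ≥ n · rank(z)` for every `z` -/

section QuadraticMatMulRank
open Module Matrix Finset Shpilka2003
variable {K : Type*} [Field K] {n : ℕ}

/-- `⟨z, x·y⟩ = ⟨xᵀ·z, y⟩`. [cite: Shpilka2003, Lemma 8 (proof)] -/
theorem Shpilka2003.frob_mul_eq (z x y : Matrix (Fin n) (Fin n) K) :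
    Shpilka2003.frob n z (x * y) = Shpilka2003.frob n (xᵀ * z) y := by
  simp only [Shpilka2003.frob_apply, Matrix.mul_apply, Matrix.transpose_apply]
  simp_rw [Finset.mul_sum, Finset.sum_mul]
  -- LHS: ∑ l, ∑ j, ∑ i, z l j * (x l i * y i j); RHS: ∑ i, ∑ j, ∑ l, x l i * z l j * y i j
  rw [Finset.sum_comm]
  conv_rhs => rw [Finset.sum_comm]
  refine Finset.sum_congr rfl fun j _ => ?_
  rw [Finset.sum_comm]
  exact Finset.sum_congr rfl fun i _ => Finset.sum_congr rfl fun l _ => by ring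

/-- The Frobenius pairing is nondegenerate: `w ↦ ⟨w, ·⟩` is injective. [cite: Shpilka2003, §4.3] -/
theorem Shpilka2003.frob_injective : Function.Injective (Shpilka2003.frob (K := K) n) := by
  refine (injective_iff_map_eq_zero _).2 fun w hw => ?_
  ext a b
  have := LinearMap.congr_fun hw (unitMat a b)
  rw [frob_unitMat] at this
  simpa using this

/-- `dim {x ↦ ⟨z, x·y⟩} ≥ n · rank z` (the left partial derivatives of `trace(x y zᵗ)` span
`{(xᵀ z)} `, of dimension `n·rank(z)`). [cite: Shpilka2003, Lemma 8 (proof), eq. (spangeq)] -/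
theorem Shpilka2003.mul_rank_le_finrank_range_compr₂_frob (z : Matrix (Fin n) (Fin n) K) :
    n * z.rank ≤ finrank K (LinearMap.range ((mulBilin K n n n).compr₂ (Shpilka2003.frob n z))) := by
  classical
  -- factor through `x ↦ xᵀ z = (zᵀ x)ᵀ`
  set T : Matrix (Fin n) (Fin n) K ≃ₗ[K] Matrix (Fin n) (Fin n) K := Matrix.transposeLinearEquiv (Fin n) (Fin n) K K with hT
  have hfac : (mulBilin K n n n).compr₂ (Shpilka2003.frob n z) =
      (Shpilka2003.frob n) ∘ₗ T.toLinearMap ∘ₗ (mulBilin K n n n zᵀ) := by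
    apply LinearMap.ext fun x => ?_
    apply LinearMap.ext fun y => ?_
    have hT' : T (zᵀ * x) = xᵀ * z := by
      change (zᵀ * x)ᵀ = xᵀ * z
      rw [Matrix.transpose_mul, Matrix.transpose_transpose]
    simp only [LinearMap.compr₂_apply, mulBilin_apply, LinearMap.comp_apply, LinearEquiv.coe_coe, hT']
    exact Shpilka2003.frob_mul_eq z x y
  rw [hfac, LinearMap.range_comp, LinearMap.range_comp]
  have hinj : Function.Injective ((Shpilka2003.frob n) ∘ₗ T.toLinearMap : Matrix (Fin n) (Fin n) K →ₗ[K] _) :=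
    Shpilka2003.frob_injective.comp T.injective
  calc n * z.rank = n * zᵀ.rank := by rw [Matrix.rank_transpose]
    _ ≤ finrank K (LinearMap.range (mulBilin K n n n zᵀ)) := Shpilka2003.mul_rank_le_finrank_range_mul zᵀ
    _ = finrank K (Submodule.map ((Shpilka2003.frob n) ∘ₗ T.toLinearMap) (LinearMap.range (mulBilin K n n n zᵀ))) :=
        (LinearEquiv.finrank_eq (Submodule.equivMapOfInjective _ hinj _))
    _ = finrank K (Submodule.map (Shpilka2003.frob n) (Submodule.map T.toLinearMap (LinearMap.range (mulBilin K n n n zᵀ)))) := by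
        rw [Submodule.map_comp]

/-- `⟨z, x·y⟩ = ⟨z·yᵀ, x⟩`. [cite: Shpilka2003, Lemma 8 (proof)] -/
theorem Shpilka2003.frob_mul_eq' (z x y : Matrix (Fin n) (Fin n) K) :
    Shpilka2003.frob n z (x * y) = Shpilka2003.frob n (z * yᵀ) x := by
  simp only [Shpilka2003.frob_apply, Matrix.mul_apply, Matrix.transpose_apply]
  simp_rw [Finset.mul_sum, Finset.sum_mul]
  -- LHS: ∑ l, ∑ j, ∑ i, z l j * (x l i * y i j); RHS: ∑ l, ∑ i, ∑ j, z l j * y i j * x l i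
  refine Finset.sum_congr rfl fun l _ => ?_
  rw [Finset.sum_comm]
  exact Finset.sum_congr rfl fun i _ => Finset.sum_congr rfl fun j _ => by ring

/-- `dim {y ↦ ⟨z, x·y⟩} ≥ n · rank z` (the right partial derivatives span `{z yᵗ}`).
[cite: Shpilka2003, Lemma 8 (proof), eq. (spangeq)] -/
theorem Shpilka2003.mul_rank_le_finrank_range_flip_compr₂_frob (z : Matrix (Fin n) (Fin n) K) :
    n * z.rank ≤
      finrank K (LinearMap.range ((mulBilin K n n n).flip.compr₂ (Shpilka2003.frob n z))) := by
  classical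
  set T : Matrix (Fin n) (Fin n) K ≃ₗ[K] Matrix (Fin n) (Fin n) K :=
    Matrix.transposeLinearEquiv (Fin n) (Fin n) K K with hT
  have hfac : (mulBilin K n n n).flip.compr₂ (Shpilka2003.frob n z) =
      (Shpilka2003.frob n) ∘ₗ (mulBilin K n n n z) ∘ₗ T.toLinearMap := by
    apply LinearMap.ext fun y => ?_
    apply LinearMap.ext fun x => ?_
    have hT' : T y = yᵀ := rfl
    simp only [LinearMap.compr₂_apply, LinearMap.flip_apply, mulBilin_apply, LinearMap.comp_apply,
      LinearEquiv.coe_coe, hT']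
    exact Shpilka2003.frob_mul_eq' z x y
  rw [hfac, LinearMap.range_comp, LinearMap.range_comp, LinearEquiv.range, Submodule.map_top]
  calc n * z.rank ≤ finrank K (LinearMap.range (mulBilin K n n n z)) :=
        Shpilka2003.mul_rank_le_finrank_range_mul z
    _ = finrank K (Submodule.map (Shpilka2003.frob n) (LinearMap.range (mulBilin K n n n z))) :=
        LinearEquiv.finrank_eq (Submodule.equivMapOfInjective _ Shpilka2003.frob_injective _)

/-- **Lemma (Shpilka 2003, Lemma 8), as printed** (every rank): «`Γ` is a linear mapping and it has
the property that for every matrix `z`, `weight(Γ(z)) ≥ n · rank(z)`» — for the third code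
`Γ(z) = (⟨z, w_t⟩)_t` of any quadratic computation of `⟨n,n,n⟩` over `𝔽₂`.
[cite: Shpilka2003, Lemma 8] -/
theorem isLinearCodeOfMatrices_code₃Mat {ι : Type*} [Fintype ι]
    (q : QuadComp (mulBilin (ZMod 2) n n n) ι) : IsLinearCodeOfMatrices n q.code₃Mat := by
  classical
  intro z
  have h := Shpilka2003.finrank_add_finrank_le_two_mul_card q (Shpilka2003.frob n z)
  have h1 := Shpilka2003.mul_rank_le_finrank_range_compr₂_frob (K := ZMod 2) z
  have h2 := Shpilka2003.mul_rank_le_finrank_range_flip_compr₂_frob (K := ZMod 2) z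
  have hw : hammingNorm (q.code₃Mat z) = #{t | Shpilka2003.frob n z (q.w t) ≠ 0} := by
    simp only [hammingNorm, QuadComp.code₃Mat_apply]
  rw [hw]
  omega

end QuadraticMatMulRank

end Literature.Computability.AlgebraicComplexity
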